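import Literature.Analysis.FunctionSpaces.EuclideanLogSobolevLipschitz
import Literature.Analysis.FunctionSpaces.SobolevDomain
import HarnessLib

/-!
# The sharp Euclidean logarithmic Sobolev inequality for functions with an `L²` weak gradient

Topic `Literature/Analysis/FunctionSpaces`; sequel of `EuclideanLogSobolev.lean` (`C¹_c` test
functions) and `EuclideanLogSobolevLipschitz.lean` (Lipschitz test functions). Here the sharp
Euclidean logarithmic Sobolev inequality in scale form,
`∫ f² log f² ≤ 4τ ∫ ‖∇f‖² − n − (n/2) log(4πτ)` (`∫ f² = 1`, `τ > 0`; Bakry–Gentil–Ledoux 2014,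
Prop. 6.2.5), is proved for **bounded, compactly supported functions with a weak gradient `g` in
`L²`** in the sense of the tree's Sobolev vocabulary (`Literature.Analysis.FunctionSpaces.HasWeakFDerivOn`,
Evans §5.2.1), `∇f` being replaced by `g`: `euclideanLogSobolev_scale_of_hasWeakFDerivOn` and its
case `n = 4`, `euclideanLogSobolev_scale_four_of_hasWeakFDerivOn`. This is the class of the
symmetric decreasing rearrangement `u♯` of a smooth compactly supported function on a manifold once
a Pólya–Szegő inequality puts it in `W^{1,2}` (Nobili–Violo; Balogh–Kristály–Tripaldi 2024, §3.1).

Proof (Evans, *PDE*, §5.3.1, Thm. 1, the mollification argument, plus the limit of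
`EuclideanLogSobolevLipschitz.lean`):

* `fderiv_normed_convolution_apply_of_hasWeakFDerivOn` — **`D(φ ⋆ f) = φ ⋆ g`**:
  `D(φ ⋆ f)_x(v) = ∫ g_y(v) φ(x − y) dy` (difference quotients of the smooth kernel against `f`,
  Mathlib `LipschitzWith.integral_inv_smul_sub_mul_tendsto_integral_lineDeriv_mul`, then the weak
  derivative identity with the test function `y ↦ φ(x − y)`);
* `norm_fderiv_normed_convolution_sq_le_of_hasWeakFDerivOn`,
  `integral_norm_fderiv_normed_convolution_sq_le_of_hasWeakFDerivOn` — `∫ ‖D(φ ⋆ f)‖² ≤ ∫ ‖g‖²`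
  (Jensen for the probability density `φ(x − ·)`, `∫ (‖g‖² ⋆ φ) = ∫ ‖g‖²`);
* `euclideanLogSobolev_scale_of_hasWeakFDerivOn` — mollify with `r_out = 1/(k+1) ≤ 2 r_in`,
  `φ_k ⋆ f → f` a.e. (Lebesgue differentiation, Mathlib
  `ContDiffBump.ae_convolution_tendsto_right_of_locallyIntegrable`), dominated convergence of norm and
  entropy on a common compact support, and the homogeneous `C¹` inequality
  `euclideanLogSobolev_scale_homogeneous`;
* `opNorm_sq_le_sum_sq_apply_basisFun`, `integrable_norm_sq_of_memLp_apply` — `‖g‖² ∈ L¹` from the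
  `L²` components supplied by `MemSobolevDomain 1 2`.

Everything is proved; no definitions, no named facts. What is NOT here: unbounded `f` or `f`
without compact support (`W^{1,2}(ℝⁿ)` in general), equality cases.

## References

* [BakryGentilLedoux2014] D. Bakry, I. Gentil, M. Ledoux, Springer 2014, Prop. 6.2.5 (p. 284).
* [Evans2010] L. C. Evans, *Partial Differential Equations*, 2nd ed., AMS 2010, §5.2.1 (weak
  derivatives), §5.3.1 Thm. 1 (mollification of Sobolev functions).
* [BaloghKristalyTripaldi2024] Z. M. Balogh, A. Kristály, F. Tripaldi, J. Funct. Anal. 286 (2024)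
  110217, §3.1 (use).
-/

noncomputable section

open MeasureTheory Set Filter Topology Metric ContinuousLinearMap TopologicalSpace
open scoped RealInnerProductSpace ENNReal NNReal Convolution

namespace Literature.Analysis.FunctionSpaces

variable {n : ℕ}

section Mollify

variable {f : EuclideanSpace ℝ (Fin n) → ℝ}
  {g : EuclideanSpace ℝ (Fin n) → EuclideanSpace ℝ (Fin n) →L[ℝ] ℝ}

/-- The mollification of a locally integrable function by a normed bump function is `C¹`. [folklore] -/
theorem contDiff_normed_convolution_of_locallyIntegrable
    (φ : ContDiffBump (0 : EuclideanSpace ℝ (Fin n))) (hf : LocallyIntegrable f volume) :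
    ContDiff ℝ 1 (φ.normed volume ⋆ f) :=
  φ.hasCompactSupport_normed.contDiff_convolution_left (lsmul ℝ ℝ) (φ.contDiff_normed (n := 1)) hf

/-- The reflected, translated kernel `y ↦ φ(x − y)` is a test function on all of `ℝⁿ`. [folklore] -/
theorem isTestFunctionOn_normed_sub (φ : ContDiffBump (0 : EuclideanSpace ℝ (Fin n)))
    (x : EuclideanSpace ℝ (Fin n)) :
    IsTestFunctionOn (⊤ : Opens (EuclideanSpace ℝ (Fin n))) fun y ↦ φ.normed volume (x - y) where
  contDiff := φ.contDiff_normed.comp (contDiff_const.sub contDiff_id)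
  hasCompactSupport := φ.hasCompactSupport_normed.comp_homeomorph (Homeomorph.subLeft x)
  tsupport_subset := by simp

/-- **Differentiating the mollification of a weakly differentiable function**: if `g` is a weak
gradient of `f` on `ℝⁿ` then `D(φ ⋆ f)_x(v) = ∫ g_y(v) φ(x − y) dy` — the difference quotients of
`φ ⋆ f` in the direction `v` are those of the smooth kernel integrated against `f`, and the weak
derivative identity moves the derivative onto `f`. [cite: Evans2010, §5.3.1 Thm. 1 (proof)] -/
theorem fderiv_normed_convolution_apply_of_hasWeakFDerivOn
    (φ : ContDiffBump (0 : EuclideanSpace ℝ (Fin n)))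
    (hw : HasWeakFDerivOn (⊤ : Opens (EuclideanSpace ℝ (Fin n))) volume f g)
    (hfi : Integrable f volume) (x v : EuclideanSpace ℝ (Fin n)) :
    fderiv ℝ (φ.normed volume ⋆ f) x v = ∫ y, g y v * φ.normed volume (x - y) := by
  set F := φ.normed volume ⋆ f with hF
  set ψ : EuclideanSpace ℝ (Fin n) → ℝ := fun y ↦ φ.normed volume (x - y) with hψ
  have hψt : IsTestFunctionOn (⊤ : Opens (EuclideanSpace ℝ (Fin n))) ψ :=
    isTestFunctionOn_normed_sub φ x
  have hψd : ContDiff ℝ 1 ψ := hψt.contDiff.of_le (by exact_mod_cast le_top)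
  have hψc : Continuous ψ := hψd.continuous
  obtain ⟨C, hψL⟩ := hψd.lipschitzWith_of_hasCompactSupport hψt.hasCompactSupport one_ne_zero
  obtain ⟨Bψ, hBψ⟩ := hψc.bounded_above_of_compact_support hψt.hasCompactSupport
  have hFd : ContDiff ℝ 1 F := contDiff_normed_convolution_of_locallyIntegrable φ hfi.locallyIntegrable
  have h1 : Tendsto (fun t : ℝ ↦ t⁻¹ • (F (x + t • v) - F x)) (𝓝[>] 0) (𝓝 (fderiv ℝ F x v)) :=
    (((hFd.differentiable one_ne_zero) x).hasFDerivAt.hasLineDerivAt v).tendsto_slope_zero_right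
  have h2 : ∀ t : ℝ, t⁻¹ • (F (x + t • v) - F x) =
      ∫ y, (t⁻¹ • (ψ (y + t • (-v)) - ψ y)) * f y := by
    intro t
    have eψ : ∀ y, φ.normed volume (x + t • v - y) = ψ (y + t • (-v)) := fun y ↦ by
      simp only [hψ, smul_neg]
      congr 1
      abel
    have hi1 : Integrable (fun y ↦ ψ (y + t • (-v)) * f y) volume :=
      hfi.bdd_mul (hψc.comp (continuous_id.add continuous_const)).aestronglyMeasurable
        (Eventually.of_forall fun y ↦ hBψ _)
    have hi2 : Integrable (fun y ↦ ψ y * f y) volume :=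
      hfi.bdd_mul hψc.aestronglyMeasurable (Eventually.of_forall fun y ↦ hBψ _)
    have e3 : (fun y ↦ f y * φ.normed volume (x + t • v - y)) = fun y ↦ ψ (y + t • (-v)) * f y := by
      funext y; rw [eψ y]; ring
    have e4 : (fun y ↦ f y * φ.normed volume (x - y)) = fun y ↦ ψ y * f y := by
      funext y; simp only [hψ]; ring
    rw [hF, normed_convolution_eq, normed_convolution_eq, e3, e4, ← integral_sub hi1 hi2,
      ← integral_smul]
    refine integral_congr_ae (Eventually.of_forall fun y ↦ ?_)
    simp only [smul_eq_mul]
    ring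
  have h3 := hψL.integral_inv_smul_sub_mul_tendsto_integral_lineDeriv_mul (μ := volume) hfi (-v)
  simp_rw [h2] at h1
  have h4 : fderiv ℝ F x v = ∫ y, lineDeriv ℝ ψ y (-v) * f y := tendsto_nhds_unique h1 h3
  have h5 : ∀ y, lineDeriv ℝ ψ y (-v) = fderiv ℝ ψ y (-v) := fun y ↦
    ((hψd.differentiable one_ne_zero) y).lineDeriv_eq_fderiv
  simp_rw [h5] at h4
  have h6 := hw.integral_fderiv_smul_eq ψ (-v) hψt
  rw [Opens.coe_top, Measure.restrict_univ] at h6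
  simp only [smul_eq_mul] at h6
  rw [h4, h6, ← integral_neg]
  refine integral_congr_ae (Eventually.of_forall fun y ↦ ?_)
  simp only [map_neg, mul_neg, neg_neg, hψ]
  ring

/-- **Pointwise energy bound** (Jensen): if `g` is a weak gradient of `f` with `‖g‖² ∈ L¹`, then
`‖D(φ ⋆ f)_x‖² ≤ ∫ ‖g_y‖² φ(x − y) dy`. [folklore] -/
theorem norm_fderiv_normed_convolution_sq_le_of_hasWeakFDerivOn
    (φ : ContDiffBump (0 : EuclideanSpace ℝ (Fin n)))
    (hw : HasWeakFDerivOn (⊤ : Opens (EuclideanSpace ℝ (Fin n))) volume f g)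
    (hfi : Integrable f volume) (hG2 : Integrable (fun y ↦ ‖g y‖ ^ 2) volume)
    (x : EuclideanSpace ℝ (Fin n)) :
    ‖fderiv ℝ (φ.normed volume ⋆ f) x‖ ^ 2 ≤ ∫ y, ‖g y‖ ^ 2 * φ.normed volume (x - y) := by
  set w : EuclideanSpace ℝ (Fin n) → ℝ := fun y ↦ φ.normed volume (x - y) with hw_def
  set G : EuclideanSpace ℝ (Fin n) → ℝ := fun y ↦ ‖g y‖ with hG
  have hw0 : ∀ y, 0 ≤ w y := fun y ↦ φ.nonneg_normed _
  have hw1 : ∫ y, w y = 1 := by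
    rw [hw_def, integral_sub_left_eq_self (fun y ↦ φ.normed volume y) volume x]
    exact φ.integral_normed
  have hwc : Continuous w := φ.continuous_normed.comp (continuous_const.sub continuous_id)
  have hws : HasCompactSupport w := φ.hasCompactSupport_normed.comp_homeomorph (Homeomorph.subLeft x)
  obtain ⟨Bw, hBw⟩ := hwc.bounded_above_of_compact_support hws
  have hgli : LocallyIntegrable g volume := by
    have h := hw.locallyIntegrableOn_deriv
    rw [Opens.coe_top, locallyIntegrableOn_univ] at h
    exact h
  have hGli : LocallyIntegrable G volume := by
    have h := hw.locallyIntegrableOn_deriv.norm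
    rw [Opens.coe_top, locallyIntegrableOn_univ] at h
    exact h
  have hGae : AEStronglyMeasurable G volume := (LocallyIntegrable.aestronglyMeasurable hgli).norm
  have hG0 : ∀ y, 0 ≤ G y := fun y ↦ norm_nonneg _
  have hwi : Integrable w volume := integrable_normed_sub φ x
  have hGwi : Integrable (fun y ↦ G y * w y) volume := by
    have h := LocallyIntegrable.integrable_smul_right_of_hasCompactSupport hGli hwc hws
    simpa only [smul_eq_mul] using h
  have hG2wi : Integrable (fun y ↦ G y ^ 2 * w y) volume :=
    hG2.mul_bdd hwc.aestronglyMeasurable (Eventually.of_forall fun y ↦ hBw y)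
  have hD : ∀ v, fderiv ℝ (φ.normed volume ⋆ f) x v = ∫ y, g y v * w y := fun v ↦
    fderiv_normed_convolution_apply_of_hasWeakFDerivOn φ hw hfi x v
  -- operator-norm bound by the average `M` of `‖g‖`
  obtain ⟨M, hM⟩ : ∃ M : ℝ, M = ∫ y, G y * w y := ⟨_, rfl⟩
  have hM0 : 0 ≤ M := hM ▸ integral_nonneg fun y ↦ mul_nonneg (hG0 y) (hw0 y)
  have hnorm : ‖fderiv ℝ (φ.normed volume ⋆ f) x‖ ≤ M := by
    refine ContinuousLinearMap.opNorm_le_bound _ hM0 fun v ↦ ?_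
    rw [hD v, Real.norm_eq_abs]
    calc |∫ y, g y v * w y| ≤ ∫ y, |g y v * w y| := abs_integral_le_integral_abs
      _ ≤ ∫ y, G y * w y * ‖v‖ := by
          refine integral_mono_of_nonneg (Eventually.of_forall fun y ↦ abs_nonneg _)
            (hGwi.mul_const _) (Eventually.of_forall fun y ↦ ?_)
          change |g y v * w y| ≤ G y * w y * ‖v‖
          rw [abs_mul, abs_of_nonneg (hw0 y)]
          have h1 : |g y v| ≤ G y * ‖v‖ := by
            rw [← Real.norm_eq_abs]
            exact (g y).le_opNorm v
          nlinarith [hw0 y, h1]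
      _ = M * ‖v‖ := by rw [integral_mul_const, hM]
  -- Jensen through the variance
  have hvar : M ^ 2 ≤ ∫ y, G y ^ 2 * w y := by
    have h0 : 0 ≤ ∫ y, (G y - M) ^ 2 * w y :=
      integral_nonneg fun y ↦ mul_nonneg (sq_nonneg _) (hw0 y)
    have e : (fun y ↦ (G y - M) ^ 2 * w y) =
        fun y ↦ (G y ^ 2 * w y - 2 * M * (G y * w y)) + M ^ 2 * w y := by
      funext y; ring
    rw [e] at h0
    have hsplit : ∫ y, G y ^ 2 * w y - 2 * M * (G y * w y) + M ^ 2 * w y =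
        (∫ y, G y ^ 2 * w y) - 2 * M * M + M ^ 2 * 1 := by
      rw [integral_add, integral_sub, integral_const_mul, integral_const_mul, hw1, ← hM]
      · exact hG2wi
      · exact hGwi.const_mul _
      · exact hG2wi.sub (hGwi.const_mul _)
      · exact hwi.const_mul _
    rw [hsplit] at h0
    nlinarith [h0]
  calc ‖fderiv ℝ (φ.normed volume ⋆ f) x‖ ^ 2 ≤ M ^ 2 := pow_le_pow_left₀ (norm_nonneg _) hnorm 2
    _ ≤ ∫ y, G y ^ 2 * w y := hvar

/-- **The Dirichlet energy of the mollification is at most that of the weak gradient**: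
`∫ ‖D(φ ⋆ f)‖² dx ≤ ∫ ‖g‖² dx`. [cite: Evans2010, §5.3.1 Thm. 1] -/
theorem integral_norm_fderiv_normed_convolution_sq_le_of_hasWeakFDerivOn
    (φ : ContDiffBump (0 : EuclideanSpace ℝ (Fin n)))
    (hw : HasWeakFDerivOn (⊤ : Opens (EuclideanSpace ℝ (Fin n))) volume f g)
    (hfi : Integrable f volume) (hfs : HasCompactSupport f)
    (hG2 : Integrable (fun y ↦ ‖g y‖ ^ 2) volume) :
    ∫ x, ‖fderiv ℝ (φ.normed volume ⋆ f) x‖ ^ 2 ≤ ∫ y, ‖g y‖ ^ 2 := by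
  have hconv : ∀ x, ∫ y, ‖g y‖ ^ 2 * φ.normed volume (x - y) =
      ((fun y ↦ ‖g y‖ ^ 2) ⋆ φ.normed volume) x := by
    intro x
    rw [convolution_def]
    simp only [lsmul_apply, smul_eq_mul]
  have hint : ∫ x, ((fun y ↦ ‖g y‖ ^ 2) ⋆ φ.normed volume) x = ∫ y, ‖g y‖ ^ 2 := by
    rw [integral_convolution (L := lsmul ℝ ℝ) hG2 φ.integrable_normed, lsmul_apply, φ.integral_normed,
      smul_eq_mul, mul_one]
  rw [← hint]
  have hFd := contDiff_normed_convolution_of_locallyIntegrable φ hfi.locallyIntegrable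
  have hFs := hasCompactSupport_normed_convolution φ hfs
  refine integral_mono ?_ (hG2.integrable_convolution _ φ.integrable_normed) fun x ↦ ?_
  · exact ((hFd.continuous_fderiv one_ne_zero).norm.pow 2).integrable_of_hasCompactSupport
      (hasCompactSupport_sq (hFs.fderiv ℝ).norm)
  · exact (norm_fderiv_normed_convolution_sq_le_of_hasWeakFDerivOn φ hw hfi hG2 x).trans (hconv x).le

end Mollify

/-! ### The inequality for bounded compactly supported functions with an `L²` weak gradient -/

/-- **The sharp Euclidean logarithmic Sobolev inequality with a weak gradient (scale form).** Let
`f : ℝⁿ → ℝ` be bounded, compactly supported, with a weak gradient `g` on `ℝⁿ`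
(`HasWeakFDerivOn ⊤ volume f g`, Evans §5.2.1) such that `‖g‖² ∈ L¹`, and `∫ f² dx = 1`. Then for
every `τ > 0`, `∫ f² log f² dx ≤ 4τ ∫ ‖g‖² dx − n − (n/2) log(4πτ)`. Proof: mollify (`f_k = φ_k ⋆ f`,
`r_out = 1/(k+1) ≤ 2 r_in`); `Df_k = φ_k ⋆ g` so `∫ ‖Df_k‖² ≤ ∫ ‖g‖²`; `f_k → f` a.e. (Lebesgue
differentiation, Mathlib `ContDiffBump.ae_convolution_tendsto_right_of_locallyIntegrable`), with
`|f_k| ≤ sup |f|` and supports in a fixed compact set, so norm and entropy converge; conclude from the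
homogeneous `C¹` inequality. This is the form consumed with `f = u♯` a Sobolev rearrangement
(Balogh–Kristály–Tripaldi 2024, §3.1; Nobili–Violo's Pólya–Szegő inequality gives `u♯ ∈ W^{1,2}`).
[cite: BakryGentilLedoux2014, Prop. 6.2.5 (p. 284); Evans2010, §5.3.1 Thm. 1] -/
theorem euclideanLogSobolev_scale_of_hasWeakFDerivOn {f : EuclideanSpace ℝ (Fin n) → ℝ}
    {g : EuclideanSpace ℝ (Fin n) → EuclideanSpace ℝ (Fin n) →L[ℝ] ℝ}
    (hw : HasWeakFDerivOn (⊤ : Opens (EuclideanSpace ℝ (Fin n))) volume f g)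
    {B : ℝ} (hB : ∀ x, |f x| ≤ B) (hfs : HasCompactSupport f)
    (hG2 : Integrable (fun x ↦ ‖g x‖ ^ 2) volume) (h1 : ∫ x, f x ^ 2 = 1) {τ : ℝ} (hτ : 0 < τ) :
    ∫ x, f x ^ 2 * Real.log (f x ^ 2) ≤
      4 * τ * (∫ x, ‖g x‖ ^ 2) - n - (n : ℝ) / 2 * Real.log (4 * Real.pi * τ) := by
  -- measurability and integrability of `f`
  have hfm : AEStronglyMeasurable f volume := by
    have h := hw.locallyIntegrableOn
    rw [Opens.coe_top, locallyIntegrableOn_univ] at h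
    exact h.aestronglyMeasurable
  have hfi : Integrable f volume := by
    rw [← integrableOn_iff_integrable_of_support_subset (subset_tsupport f)]
    exact Measure.integrableOn_of_bounded (M := B) hfs.isCompact.measure_lt_top.ne hfm
      (Eventually.of_forall fun x ↦ by rw [Real.norm_eq_abs]; exact hB x)
  -- a sequence of normed bump functions of radii `1/(k+2) < 1/(k+1)`
  obtain ⟨φ, hφ, hφ'⟩ : ∃ φ : ℕ → ContDiffBump (0 : EuclideanSpace ℝ (Fin n)),
      (∀ k, (φ k).rOut = 1 / ((k : ℝ) + 1)) ∧ ∀ k, (φ k).rIn = 1 / ((k : ℝ) + 2) :=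
    ⟨fun k ↦ ⟨1 / ((k : ℝ) + 2), 1 / ((k : ℝ) + 1), by positivity,
      one_div_lt_one_div_of_lt (by positivity) (by linarith)⟩, fun k ↦ rfl, fun k ↦ rfl⟩
  set F : ℕ → EuclideanSpace ℝ (Fin n) → ℝ := fun k ↦ (φ k).normed volume ⋆ f with hF
  have hFd : ∀ k, ContDiff ℝ 1 (F k) := fun k ↦
    contDiff_normed_convolution_of_locallyIntegrable (φ k) hfi.locallyIntegrable
  have hFs : ∀ k, HasCompactSupport (F k) := fun k ↦ hasCompactSupport_normed_convolution (φ k) hfs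
  -- a.e. convergence `F k x → f x` (Lebesgue differentiation)
  have hrout : Tendsto (fun k ↦ (φ k).rOut) atTop (𝓝 0) := by
    simp_rw [hφ]
    exact tendsto_one_div_add_atTop_nhds_zero_nat
  have hratio : ∀ᶠ k in atTop, (φ k).rOut ≤ 2 * (φ k).rIn := by
    refine Eventually.of_forall fun k ↦ ?_
    rw [hφ, hφ', mul_one_div, div_le_div_iff₀ (by positivity) (by positivity)]
    linarith [(k.cast_nonneg : (0 : ℝ) ≤ k)]
  have hptw : ∀ᵐ x ∂volume, Tendsto (fun k ↦ F k x) atTop (𝓝 (f x)) :=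
    ContDiffBump.ae_convolution_tendsto_right_of_locallyIntegrable hrout hratio hfi.locallyIntegrable
  -- uniform bound and common compact support
  have hFB : ∀ k x, |F k x| ≤ B := fun k x ↦ abs_normed_convolution_le (φ k) hB x
  set K : Set (EuclideanSpace ℝ (Fin n)) := cthickening 1 (tsupport f) with hK_def
  have hK : IsCompact K := hfs.isCompact.cthickening
  have hFK : ∀ k x, x ∉ K → F k x = 0 := by
    intro k x hx
    refine normed_convolution_eq_zero_of_infDist (φ k) fun hx' ↦ hx ?_
    have hr : (φ k).rOut ≤ 1 := by
      rw [hφ k, div_le_one (by positivity)]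
      linarith [(k.cast_nonneg : (0 : ℝ) ≤ k)]
    exact ((thickening_mono hr _).trans ((thickening_subset_cthickening 1 _).trans
      (cthickening_subset_of_subset 1 (subset_tsupport f)))) hx'
  have hKi : ∀ c : ℝ, Integrable (K.indicator fun _ ↦ c) volume := fun c ↦
    (integrable_indicator_iff hK.measurableSet).2 (integrableOn_const hK.measure_lt_top.ne)
  -- `∫ F_k² → 1`
  have ha : Tendsto (fun k ↦ ∫ x, F k x ^ 2) atTop (𝓝 1) := by
    rw [← h1]
    refine tendsto_integral_of_dominated_convergence (K.indicator fun _ ↦ B ^ 2)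
      (fun k ↦ ((hFd k).continuous.pow 2).aestronglyMeasurable) (hKi _) (fun k ↦ ?_) ?_
    · refine Eventually.of_forall fun x ↦ ?_
      by_cases hx : x ∈ K
      · rw [indicator_of_mem hx, Real.norm_eq_abs, abs_pow]
        exact pow_le_pow_left₀ (abs_nonneg _) (hFB k x) 2
      · rw [indicator_of_notMem hx, hFK k x hx]
        simp
    · filter_upwards [hptw] with x hx using hx.pow 2
  -- `∫ F_k² log F_k² → ∫ f² log f²`
  have hcont : Continuous fun s : ℝ ↦ s ^ 2 * Real.log (s ^ 2) :=
    Real.continuous_mul_log.comp (continuous_pow 2)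
  obtain ⟨B', hB'⟩ : ∃ B' : ℝ, ∀ s : ℝ, |s| ≤ B → |s ^ 2 * Real.log (s ^ 2)| ≤ B' := by
    obtain ⟨B', hB'⟩ := (isCompact_Icc : IsCompact (Icc (-B) B)).exists_bound_of_continuousOn
      hcont.continuousOn
    exact ⟨B', fun s hs ↦ by simpa only [Real.norm_eq_abs] using hB' s (mem_Icc.2 (abs_le.1 hs))⟩
  have he : Tendsto (fun k ↦ ∫ x, F k x ^ 2 * Real.log (F k x ^ 2)) atTop
      (𝓝 (∫ x, f x ^ 2 * Real.log (f x ^ 2))) := by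
    refine tendsto_integral_of_dominated_convergence (K.indicator fun _ ↦ B')
      (fun k ↦ (hcont.comp (hFd k).continuous).aestronglyMeasurable) (hKi _) (fun k ↦ ?_) ?_
    · refine Eventually.of_forall fun x ↦ ?_
      by_cases hx : x ∈ K
      · rw [indicator_of_mem hx, Real.norm_eq_abs]
        exact hB' _ (hFB k x)
      · rw [indicator_of_notMem hx, hFK k x hx]
        simp
    · filter_upwards [hptw] with x hx using (hcont.tendsto _).comp hx
  -- the homogeneous `C¹` inequality for `F k`, with the energy of `g` (eventually `∫ F_k² > 0`)
  have hev : ∀ᶠ k in atTop, 0 < ∫ x, F k x ^ 2 := (tendsto_order.1 ha).1 0 one_pos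
  obtain ⟨c, hc⟩ : ∃ c : ℝ, c = n + (n : ℝ) / 2 * Real.log (4 * Real.pi * τ) := ⟨_, rfl⟩
  have hineq : ∀ᶠ k in atTop,
      (∫ x, F k x ^ 2 * Real.log (F k x ^ 2)) - (∫ x, F k x ^ 2) * Real.log (∫ x, F k x ^ 2) +
        (∫ x, F k x ^ 2) * c ≤ 4 * τ * (∫ x, ‖g x‖ ^ 2) := by
    filter_upwards [hev] with k hk
    have h := euclideanLogSobolev_scale_homogeneous (hFd k) (hFs k) hk hτ
    rw [← hc] at h
    have hE : ∫ x, ‖fderiv ℝ (F k) x‖ ^ 2 ≤ ∫ x, ‖g x‖ ^ 2 :=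
      integral_norm_fderiv_normed_convolution_sq_le_of_hasWeakFDerivOn (φ k) hw hfi hfs hG2
    have hE' := mul_le_mul_of_nonneg_left hE (by positivity : (0 : ℝ) ≤ 4 * τ)
    linarith
  -- pass to the limit
  have hlim : Tendsto (fun k ↦ (∫ x, F k x ^ 2 * Real.log (F k x ^ 2)) -
      (∫ x, F k x ^ 2) * Real.log (∫ x, F k x ^ 2) + (∫ x, F k x ^ 2) * c) atTop
      (𝓝 ((∫ x, f x ^ 2 * Real.log (f x ^ 2)) - 1 * Real.log 1 + 1 * c)) :=
    (he.sub (ha.mul (ha.log one_ne_zero))).add (ha.mul_const c)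
  have hfin := le_of_tendsto hlim hineq
  rw [Real.log_one, mul_zero, sub_zero, one_mul, hc] at hfin
  linarith

/-- The case `n = 4` in the numeric shape of `Literature.Geometry.Riemannian.sharpLogSobolevAVR_four`
(`θ = 1`), with a weak gradient. [cite: BakryGentilLedoux2014, Prop. 6.2.5 (p. 284)] -/
theorem euclideanLogSobolev_scale_four_of_hasWeakFDerivOn {f : EuclideanSpace ℝ (Fin 4) → ℝ}
    {g : EuclideanSpace ℝ (Fin 4) → EuclideanSpace ℝ (Fin 4) →L[ℝ] ℝ}
    (hw : HasWeakFDerivOn (⊤ : Opens (EuclideanSpace ℝ (Fin 4))) volume f g)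
    {B : ℝ} (hB : ∀ x, |f x| ≤ B) (hfs : HasCompactSupport f)
    (hG2 : Integrable (fun x ↦ ‖g x‖ ^ 2) volume) (h1 : ∫ x, f x ^ 2 = 1) {τ : ℝ} (hτ : 0 < τ) :
    ∫ x, f x ^ 2 * Real.log (f x ^ 2) ≤
      4 * τ * (∫ x, ‖g x‖ ^ 2) - 2 * Real.log (4 * Real.pi * τ) - 4 := by
  have h := euclideanLogSobolev_scale_of_hasWeakFDerivOn hw hB hfs hG2 h1 hτ
  simp only [Nat.cast_ofNat] at h
  linarith

/-! ### From `W^{1,2}` membership to an `L²` bound on the operator norm of the weak gradient -/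

/-- On Euclidean space, `‖A‖² ≤ Σᵢ (A eᵢ)²` for a real linear functional `A` and the standard
orthonormal basis `(eᵢ)` (Cauchy–Schwarz in coordinates; in fact equality). [folklore] -/
theorem opNorm_sq_le_sum_sq_apply_basisFun (A : EuclideanSpace ℝ (Fin n) →L[ℝ] ℝ) :
    ‖A‖ ^ 2 ≤ ∑ i, (A (EuclideanSpace.basisFun (Fin n) ℝ i)) ^ 2 := by
  set b := EuclideanSpace.basisFun (Fin n) ℝ with hb
  have hS : 0 ≤ ∑ i, (A (b i)) ^ 2 := Finset.sum_nonneg fun i _ ↦ sq_nonneg _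
  have hbound : ‖A‖ ≤ Real.sqrt (∑ i, (A (b i)) ^ 2) := by
    refine ContinuousLinearMap.opNorm_le_bound _ (Real.sqrt_nonneg _) fun v ↦ ?_
    have hv : A v = ∑ i, v i * A (b i) := by
      conv_lhs => rw [← b.sum_repr' v]
      rw [map_sum]
      refine Finset.sum_congr rfl fun i _ ↦ ?_
      rw [map_smul, smul_eq_mul, ← b.repr_apply_apply, hb]
      rfl
    have hnorm : Real.sqrt (∑ i, v i ^ 2) = ‖v‖ := by
      rw [EuclideanSpace.norm_eq]
      congr 1
      refine Finset.sum_congr rfl fun i _ ↦ ?_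
      rw [Real.norm_eq_abs, sq_abs]
    rw [Real.norm_eq_abs, hv, abs_le]
    constructor
    · have h := Real.sum_mul_le_sqrt_mul_sqrt Finset.univ (fun i ↦ -v i) (fun i ↦ A (b i))
      simp only [neg_mul, Finset.sum_neg_distrib, even_two, Even.neg_pow] at h
      rw [hnorm] at h
      linarith
    · have h := Real.sum_mul_le_sqrt_mul_sqrt Finset.univ (fun i ↦ v i) (fun i ↦ A (b i))
      rw [hnorm] at h
      linarith
  calc ‖A‖ ^ 2 ≤ (Real.sqrt (∑ i, (A (b i)) ^ 2)) ^ 2 := pow_le_pow_left₀ (norm_nonneg _) hbound 2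
    _ = ∑ i, (A (b i)) ^ 2 := Real.sq_sqrt hS

/-- If every directional component `x ↦ g_x(w)` of a measurable field of linear functionals is in
`L²`, then `‖g‖² ∈ L¹` (the data `MemSobolevDomain 1 2` provides). [folklore] -/
theorem integrable_norm_sq_of_memLp_apply
    {g : EuclideanSpace ℝ (Fin n) → EuclideanSpace ℝ (Fin n) →L[ℝ] ℝ}
    (hg : AEStronglyMeasurable g volume) (h : ∀ w, MemLp (fun x ↦ g x w) 2 volume) :
    Integrable (fun x ↦ ‖g x‖ ^ 2) volume := by
  set b := EuclideanSpace.basisFun (Fin n) ℝ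
  have hi : ∀ i, Integrable (fun x ↦ (g x (b i)) ^ 2) volume := fun i ↦
    (memLp_two_iff_integrable_sq (h (b i)).1).1 (h (b i))
  have hsum : Integrable (fun x ↦ ∑ i, (g x (b i)) ^ 2) volume :=
    integrable_finsetSum _ fun i _ ↦ hi i
  refine hsum.mono' (hg.norm.pow 2) (Eventually.of_forall fun x ↦ ?_)
  rw [Real.norm_eq_abs, abs_of_nonneg (sq_nonneg _)]
  exact opNorm_sq_le_sum_sq_apply_basisFun (g x)

end Literature.Analysis.FunctionSpaces
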